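import Summits.ABC.ABC.Theses.FeketeScales
import Literature.NumberTheory.DiophantineGeometry.AbcWave0QualityFormProofs
import HarnessLib

/-!
# Route FeketeScales — crux `SparseGoodScales` (stmt-ABC-2161): what the horizontal stub of line
# `SketchIdeator4` needs — a PAIRWISE repulsion of exceptional radicals gives DA∃

Helper file (`--supports stmt-ABC-2161`) for the crux `SparseGoodScales` of route `FeketeScales`,
line `SketchIdeator4` (skeleton `Cruxes/SparseGoodScales/Lines/SketchIdeator4.lean`, stubs
`stub_scaleSubmultiplicativity` = the sister crux stmt-ABC-2160 and `stub_droughtsOfSomeRatio` =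
DA∃).  It records, kernel-checked, the WEAKEST engine that would settle the open stub DA∃
("for every `δ > 0` the radicals of the `(1+δ)`-exceptional abc triples omit, infinitely often, a
window `(R^{1/Λ}, R]` of some fixed ratio `Λ(δ) > 1`"): a pairwise gap principle in radical scale,

  RadicalRepulsion := ∀ δ > 0, ∃ κ > 0, ∃ r₀, for all `(1+δ)`-exceptional abc triples `T, T'`
  (`c > rad^{1+δ}`) with `r₀ ≤ rad T < rad T'`:  `(rad T)^{1+κ} ≤ rad T'`

(written inline below; "consecutive exceptional radicals repel polynomially", the template of
Thue–Siegel / Landau–Page gap principles; `BarrierNotes-r2-k4.md` §2 "DA∃ is the statement the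
FIRST gap principle of any strength would settle").  No such principle is known for abc triples of
varying support (`BarrierNotes-r1-k2.md` N5, `-r2-k5.md` R7); this file only fixes the target.

* `droughtsOfSomeRatio_of_radicalRepulsion` : RadicalRepulsion → DA∃, with `Λ(δ) = 1 + κ(δ)/2`.

Proof: given `N`, put `r₁ = max r₀ ⌈2^{2/κ}⌉` and `R_min = max N ⌈r₁^Λ⌉`.  If some exceptional
`T'` has `rad T' ≥ R_min + 1`, the scale `R = rad T' − 1` works: an exceptional `T` in the window
has `r = rad T < rad T'`, and either `r < r₁` (then `r^Λ < r₁^Λ ≤ R`, not in the window) or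
`r^{1+κ} ≤ rad T' = R + 1 ≤ 2R < 2r^Λ`, against `r^{1+κ} = r^Λ r^{κ/2} ≥ 2 r^Λ`.  Otherwise every
exceptional radical is `≤ R_min` and `R = ⌈(R_min+1)^Λ⌉` has an exceptional-free window.
-/

-- `Summit.<Summit>.<Problem>` is the mandated summit-side namespace (CONVENTIONS §2); for the
-- single-conjunct summit `ABC` the two coincide, so the duplicate `ABC.ABC` is deliberate.
set_option linter.dupNamespace false

namespace Summit.ABC.ABC.Theorems.SparseGoodScales

open Literature.NumberTheory.DiophantineGeometry
open Summit.ABC.ABC.Theses.FeketeScales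

/-- **Pairwise repulsion of exceptional radicals gives droughts of some ratio (DA∃).**
If for every `δ > 0` there are `κ > 0` and `r₀` such that any two `(1+δ)`-exceptional abc triples
`T, T'` (`c > rad^{1+δ}`) with `r₀ ≤ rad T < rad T'` satisfy `(rad T)^{1+κ} ≤ rad T'`, then for
every `δ > 0` there is `Λ > 1` (namely `1 + κ/2`) such that arbitrarily large scales `R` carry no
`(1+δ)`-exceptional triple with `rad ≤ R < rad^Λ` — the horizontal stub `stub_droughtsOfSomeRatio`
of line `SketchIdeator4`. [folklore] -/
theorem droughtsOfSomeRatio_of_radicalRepulsion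
    (h : ∀ δ : ℝ, 0 < δ → ∃ κ : ℝ, 0 < κ ∧ ∃ r₀ : ℕ, ∀ a b c a' b' c' : ℕ,
      IsABCTriple a b c → IsABCTriple a' b' c' →
      ((rad a b c : ℕ) : ℝ) ^ (1 + δ) < c → ((rad a' b' c' : ℕ) : ℝ) ^ (1 + δ) < c' →
      r₀ ≤ rad a b c → rad a b c < rad a' b' c' →
      ((rad a b c : ℕ) : ℝ) ^ (1 + κ) ≤ ((rad a' b' c' : ℕ) : ℝ)) :
    ∀ δ : ℝ, 0 < δ → ∃ Λ : ℝ, 1 < Λ ∧ ∀ N : ℕ, ∃ R : ℕ, N ≤ R ∧ ∀ a b c : ℕ,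
      IsABCTriple a b c → rad a b c ≤ R → (R : ℝ) < ((rad a b c : ℕ) : ℝ) ^ Λ →
        (c : ℝ) ≤ ((rad a b c : ℕ) : ℝ) ^ (1 + δ) := by
  intro δ hδ
  obtain ⟨κ, hκ, r₀, hgap⟩ := h δ hδ
  set Λ : ℝ := 1 + κ / 2 with hΛ_def
  have hΛ1 : 1 < Λ := by rw [hΛ_def]; linarith
  have hΛ0 : 0 < Λ := by linarith
  refine ⟨Λ, hΛ1, fun N => ?_⟩
  -- `r₁`: beyond it `r^{κ/2} ≥ 2`
  set r₁ : ℕ := max r₀ ⌈(2 : ℝ) ^ (2 / κ)⌉₊ with hr₁_def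
  have hr₀r₁ : r₀ ≤ r₁ := le_max_left _ _
  have hr₁pow : ∀ r : ℕ, r₁ ≤ r → (2 : ℝ) ≤ (r : ℝ) ^ (κ / 2) := by
    intro r hr
    have h2 : (2 : ℝ) ^ (2 / κ) ≤ (r : ℝ) := by
      have h1 : (2 : ℝ) ^ (2 / κ) ≤ (⌈(2 : ℝ) ^ (2 / κ)⌉₊ : ℝ) := Nat.le_ceil _
      have h3 : ((⌈(2 : ℝ) ^ (2 / κ)⌉₊ : ℕ) : ℝ) ≤ (r : ℝ) := by
        exact_mod_cast le_trans (le_max_right _ _) hr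
      exact h1.trans h3
    have h4 : ((2 : ℝ) ^ (2 / κ)) ^ (κ / 2) ≤ (r : ℝ) ^ (κ / 2) :=
      Real.rpow_le_rpow (by positivity) h2 (by positivity)
    have h5 : ((2 : ℝ) ^ (2 / κ)) ^ (κ / 2) = 2 := by
      rw [← Real.rpow_mul (by norm_num : (0 : ℝ) ≤ 2)]
      have : 2 / κ * (κ / 2) = 1 := by field_simp
      rw [this, Real.rpow_one]
    linarith [h4, h5]
  -- `Rmin`: at least `N` and at least `r₁^Λ`
  set Rmin : ℕ := max N ⌈((r₁ : ℕ) : ℝ) ^ Λ⌉₊ with hRmin_def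
  have hNRmin : N ≤ Rmin := le_max_left _ _
  have hRmin_pow : ((r₁ : ℕ) : ℝ) ^ Λ ≤ (Rmin : ℝ) := by
    have h1 : ((r₁ : ℕ) : ℝ) ^ Λ ≤ (⌈((r₁ : ℕ) : ℝ) ^ Λ⌉₊ : ℝ) := Nat.le_ceil _
    have h2 : ((⌈((r₁ : ℕ) : ℝ) ^ Λ⌉₊ : ℕ) : ℝ) ≤ (Rmin : ℝ) := by
      exact_mod_cast (le_max_right _ _ : ⌈((r₁ : ℕ) : ℝ) ^ Λ⌉₊ ≤ Rmin)
    exact h1.trans h2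
  -- small radicals never lie in a window above `Rmin`
  have hsmall : ∀ (R : ℕ) (a b c : ℕ), Rmin ≤ R → rad a b c < r₁ →
      ¬ ((R : ℝ) < ((rad a b c : ℕ) : ℝ) ^ Λ) := by
    intro R a b c hR hr hwin
    have h1 : ((rad a b c : ℕ) : ℝ) ^ Λ < ((r₁ : ℕ) : ℝ) ^ Λ :=
      Real.rpow_lt_rpow (Nat.cast_nonneg _) (by exact_mod_cast hr) hΛ0
    have h2 : (Rmin : ℝ) ≤ (R : ℝ) := by exact_mod_cast hR
    linarith
  by_cases hex : ∃ a' b' c' : ℕ, IsABCTriple a' b' c' ∧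
      ((rad a' b' c' : ℕ) : ℝ) ^ (1 + δ) < c' ∧ Rmin + 1 ≤ rad a' b' c'
  · -- Case 1: a far exceptional triple `T'`; take `R = rad T' - 1`
    obtain ⟨a', b', c', hT', hexc', hfar⟩ := hex
    refine ⟨rad a' b' c' - 1, by omega, fun a b c hT hrad hwin => ?_⟩
    by_contra hc
    push Not at hc
    have hRminR : Rmin ≤ rad a' b' c' - 1 := by omega
    -- the radical `r` of `T` is at least `r₁` (else `T` is not in the window)
    have hr₁r : r₁ ≤ rad a b c := by
      by_contra hlt
      push Not at hlt
      exact hsmall _ a b c hRminR hlt hwin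
    have hlt' : rad a b c < rad a' b' c' := by omega
    have hg := hgap a b c a' b' c' hT hT' hc hexc' (hr₀r₁.trans hr₁r) hlt'
    -- `2 r^Λ ≤ r^{1+κ} ≤ rad T' = R + 1 ≤ 2R < 2 r^Λ`
    have hr2 : 2 ≤ rad a b c := hT.two_le_rad
    have hrpos : (0 : ℝ) < ((rad a b c : ℕ) : ℝ) := by positivity
    have hsplit : ((rad a b c : ℕ) : ℝ) ^ (1 + κ) =
        ((rad a b c : ℕ) : ℝ) ^ Λ * ((rad a b c : ℕ) : ℝ) ^ (κ / 2) := by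
      rw [← Real.rpow_add hrpos, hΛ_def]
      congr 1
      ring
    have htwo : (2 : ℝ) ≤ ((rad a b c : ℕ) : ℝ) ^ (κ / 2) := hr₁pow _ hr₁r
    have hΛpos : (0 : ℝ) < ((rad a b c : ℕ) : ℝ) ^ Λ := Real.rpow_pos_of_pos hrpos Λ
    have hlow : 2 * ((rad a b c : ℕ) : ℝ) ^ Λ ≤ ((rad a b c : ℕ) : ℝ) ^ (1 + κ) := by
      rw [hsplit]
      nlinarith
    have hR1 : (1 : ℝ) ≤ ((rad a' b' c' - 1 : ℕ) : ℝ) := by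
      have : 1 ≤ rad a' b' c' - 1 := by
        have := hT'.two_le_rad
        omega
      exact_mod_cast this
    have hcast : ((rad a' b' c' : ℕ) : ℝ) = ((rad a' b' c' - 1 : ℕ) : ℝ) + 1 := by
      have h2 : 1 ≤ rad a' b' c' := by have := hT'.two_le_rad; omega
      rw [Nat.cast_sub h2]
      push_cast
      ring
    have hup : ((rad a b c : ℕ) : ℝ) ^ (1 + κ) < 2 * ((rad a b c : ℕ) : ℝ) ^ Λ := by
      calc ((rad a b c : ℕ) : ℝ) ^ (1 + κ) ≤ ((rad a' b' c' : ℕ) : ℝ) := hg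
        _ = ((rad a' b' c' - 1 : ℕ) : ℝ) + 1 := hcast
        _ ≤ 2 * ((rad a' b' c' - 1 : ℕ) : ℝ) := by linarith
        _ < 2 * ((rad a b c : ℕ) : ℝ) ^ Λ := by linarith
    linarith
  · -- Case 2: every exceptional radical is `≤ Rmin`; take `R = ⌈(Rmin + 1)^Λ⌉`
    push Not at hex
    have hbase1 : (1 : ℝ) ≤ ((Rmin + 1 : ℕ) : ℝ) := by
      exact_mod_cast (by omega : 1 ≤ Rmin + 1)
    have hself : ((Rmin + 1 : ℕ) : ℝ) ≤ ((Rmin + 1 : ℕ) : ℝ) ^ Λ := by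
      have := Real.rpow_le_rpow_of_exponent_le hbase1 hΛ1.le
      rwa [Real.rpow_one] at this
    have hceil : ((Rmin + 1 : ℕ) : ℝ) ^ Λ ≤ ((⌈((Rmin + 1 : ℕ) : ℝ) ^ Λ⌉₊ : ℕ) : ℝ) :=
      Nat.le_ceil _
    refine ⟨⌈((Rmin + 1 : ℕ) : ℝ) ^ Λ⌉₊, ?_, fun a b c hT hrad hwin => ?_⟩
    · have h1 : ((Rmin + 1 : ℕ) : ℝ) ≤ ((⌈((Rmin + 1 : ℕ) : ℝ) ^ Λ⌉₊ : ℕ) : ℝ) :=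
        hself.trans hceil
      have h2 : Rmin + 1 ≤ ⌈((Rmin + 1 : ℕ) : ℝ) ^ Λ⌉₊ := by exact_mod_cast h1
      omega
    · by_contra hc
      push Not at hc
      have hlt : rad a b c < Rmin + 1 := hex a b c hT hc
      have h1 : ((rad a b c : ℕ) : ℝ) ^ Λ < ((Rmin + 1 : ℕ) : ℝ) ^ Λ :=
        Real.rpow_lt_rpow (Nat.cast_nonneg _) (by exact_mod_cast hlt) hΛ0
      linarith

/-- **Radical repulsion ⟹ DA∃, registered form** (the sub-goal of stmt-ABC-2161 this file serves,
on one line: it is the signature registered on the item).  This is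
`droughtsOfSomeRatio_of_radicalRepulsion`. [folklore] -/
theorem sparseGoodScales_droughts_of_radicalRepulsion : (∀ δ : ℝ, 0 < δ → ∃ κ : ℝ, 0 < κ ∧ ∃ r₀ : ℕ, ∀ a b c a' b' c' : ℕ, IsABCTriple a b c → IsABCTriple a' b' c' → ((rad a b c : ℕ) : ℝ) ^ (1 + δ) < c → ((rad a' b' c' : ℕ) : ℝ) ^ (1 + δ) < c' → r₀ ≤ rad a b c → rad a b c < rad a' b' c' → ((rad a b c : ℕ) : ℝ) ^ (1 + κ) ≤ ((rad a' b' c' : ℕ) : ℝ)) → ∀ δ : ℝ, 0 < δ → ∃ Λ : ℝ, 1 < Λ ∧ ∀ N : ℕ, ∃ R : ℕ, N ≤ R ∧ ∀ a b c : ℕ, IsABCTriple a b c → rad a b c ≤ R → (R : ℝ) < ((rad a b c : ℕ) : ℝ) ^ Λ → (c : ℝ) ≤ ((rad a b c : ℕ) : ℝ) ^ (1 + δ) :=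
  fun h => droughtsOfSomeRatio_of_radicalRepulsion h

end Summit.ABC.ABC.Theorems.SparseGoodScales
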